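import Literature.NumberTheory.LFunctions.ZetaConvexityBound
import Summits.RiemannHypothesis.RiemannHypothesis.Theorems.JensenLogBandGammaFactorMonotone
import HarnessLib

/-!
# The flat majorant of `ξ` in the closed strip `0 ≤ σ ≤ 1 + δ` (BAND crux, far-zone input F2)

RH ladder column JENSEN, rung J-P(P3) «log band», BAND crux `XiDerivBandRealAllRates`
(stmt-RiemannHypothesis-19913) of route «JensenLogBand», line «band-one-window» (u-arc reshape,
lead rh-jensen-prover g7) — FAR-ZONE input of HOME/rh-jensen-prover/g7-work/LINE-PLAN.md §8.2.
RH-FREE classical analysis. WHAT THIS IS NOT: nothing here bears on zeros of `ζ` or the truth of RH.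

**The majorant** (`norm_riemannXi_le_strip_majorant`, `…'` for a complex point): for
`0 ≤ σ ≤ 1 + δ`, `0 < δ ≤ 1`, `t ≥ 12`,

  `‖ξ(σ + it)‖ ≤ 672 · log t · ‖γ̃(1 + δ + it)‖`.

Proof: on `½ ≤ σ ≤ 1` the tree's explicit convexity bound
`‖ζ(σ+it)‖ ≤ 32 t^{(1−σ)/2} log t` (`Literature…norm_riemannZeta_le_convexity_strip`,
Titchmarsh (5.1.4)) is multiplied by the horizontal `γ̃`-comparison of F1
(`norm_xiGammaFactor_le_of_re_le`: `‖γ̃(σ+it)‖ ≤ ‖γ̃(1+δ+it)‖ e^{−(1+δ−σ)(ℓ_t/2 − 6/t)}`): the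
power `t^{(1−σ)/2}` is exactly cancelled by `e^{−(1−σ)ℓ_t/2}`, leaving `(2π)^{(1+δ−σ)/2} e^{9/t} ≤ e³`
(`strip_exponent_le`); on `1 ≤ σ ≤ 1 + δ` the tree's `‖ζ‖ ≤ 21 log t`
(`ZetaOneLine.norm_riemannZeta_le_log`); on `0 ≤ σ < ½` the functional equation and Schwarz
reflection `‖ξ(σ+it)‖ = ‖ξ((1−σ)+it)‖` (`norm_riemannXi_reflect`).

USE (far zone of the BAND line): the competitor half-arc of `U(−a+iT)` lies entirely in
`0 ≤ Re s < 1 + δ₁`, so `sup_arc ‖ξ(½+u)‖ ≤ 672·log(T+h)·sup_{|t−T| ≤ h} ‖γ̃(1+δ₁+it)‖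
≤ 672·log(T+h)·e^{(π/4+6/(T−h))h}·‖γ̃(1+δ₁+iT)‖` (`norm_xiGammaFactor_vertical_le_symm`) — an upper
bound for the competitor with NO saddle analysis, to be compared with the lead's window lower bound
at `σ* ≥ 1 + 3δ₁` through `norm_xiGammaFactor_le_of_re_le` (factor `e^{−δ₁ℓ_T}`).

(prover-rh-jensen-eng-2-g6-0, 2026-08-27.)
-/

noncomputable section

-- single-problem summit: `Summit.RiemannHypothesis.RiemannHypothesis.…` is the tree convention
set_option linter.dupNamespace false

open Complex Real Set

namespace Summit.RiemannHypothesis.RiemannHypothesis.Theorems.JensenPolynomials.LogBandArc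

open Literature.NumberTheory.LFunctions

/-! ## Elementary pieces -/

/-- `‖ξ(s)‖ = ‖γ̃(s)‖ · ‖ζ(s)‖` for `Re s > 0`, `s ≠ 1`. RH-FREE. [folklore] -/
theorem norm_riemannXi_eq_mul {s : ℂ} (hs : 0 < s.re) (hs1 : s ≠ 1) :
    ‖riemannXi s‖ = ‖xiGammaFactor s‖ * ‖riemannZeta s‖ := by
  rw [riemannXi_eq_xiGammaFactor_mul hs hs1, norm_mul]

/-- **Reflection:** `‖ξ(σ + it)‖ = ‖ξ((1 − σ) + it)‖` (functional equation `ξ(1−s) = ξ(s)` and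
Schwarz reflection `ξ(s̄) = conj ξ(s)`). RH-FREE. [folklore] -/
theorem norm_riemannXi_reflect (σ t : ℝ) :
    ‖riemannXi ((σ : ℂ) + t * I)‖ = ‖riemannXi (((1 - σ : ℝ) : ℂ) + t * I)‖ := by
  have h1 : riemannXi ((σ : ℂ) + t * I) = riemannXi (1 - ((σ : ℂ) + t * I)) :=
    (riemannXi_one_sub _).symm
  have h2 : (1 : ℂ) - ((σ : ℂ) + t * I) = starRingEnd ℂ (((1 - σ : ℝ) : ℂ) + t * I) := by
    apply Complex.ext <;> simp
  rw [h1, h2, riemannXi_conj_holds, Complex.norm_conj]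

/-- `exp 3 < 21`. [folklore] -/
theorem exp_three_lt : Real.exp 3 < 21 := by
  have h := Real.exp_one_lt_d9
  have e : Real.exp 3 = Real.exp 1 ^ 3 := by
    rw [← Real.exp_nat_mul]; norm_num
  rw [e]
  calc Real.exp 1 ^ 3 < 2.7182818286 ^ 3 := by gcongr
    _ < 21 := by norm_num

/-- `log(2π) ≤ 2`. [folklore] -/
theorem log_two_pi_le_two : Real.log (2 * π) ≤ 2 := by
  rw [Real.log_le_iff_le_exp (by positivity)]
  have h := Real.exp_one_gt_d9
  have e : Real.exp 2 = Real.exp 1 ^ 2 := by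
    rw [← Real.exp_nat_mul]; norm_num
  rw [e]
  nlinarith [Real.pi_lt_d2, Real.exp_pos 1]

/-- `ℓ_t = log(t/2π) ≥ 0` for `t ≥ 12`. [folklore] -/
theorem ell_nonneg_of_ge {t : ℝ} (ht : 12 ≤ t) : 0 ≤ ell t := by
  rw [ell]
  apply Real.log_nonneg
  rw [le_div_iff₀ (by positivity)]
  nlinarith [Real.pi_lt_d2]

/-- **The cancellation:** for `½ ≤ σ ≤ 1`, `0 < δ ≤ 1`, `t ≥ 12`,
`e^{−(1+δ−σ)(ℓ_t/2 − 6/t)} · t^{(1−σ)/2} ≤ 21` — the convexity power `t^{(1−σ)/2}` is exactly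
`e^{(1−σ)(log t)/2}`, cancelled by `e^{−(1−σ)ℓ_t/2}` up to `(2π)^{(1−σ)/2}`; what remains is
`e^{−δ(log t)/2} (2π)^{(1+δ−σ)/2} e^{6(1+δ−σ)/t} ≤ e^{(3/2)(1 + 1/2)} ≤ e³`. RH-FREE. [folklore] -/
theorem strip_exponent_le {σ δ t : ℝ} (hσ : 1 / 2 ≤ σ) (hδ : 0 < δ) (hδ1 : δ ≤ 1)
    (ht : 12 ≤ t) :
    Real.exp (-((1 + δ - σ) * (ell t / 2 - 6 / t))) * t ^ ((1 - σ) / 2) ≤ 21 := by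
  have ht0 : 0 < t := by linarith
  rw [Real.rpow_def_of_pos ht0, ← Real.exp_add]
  have hell : ell t = Real.log t - Real.log (2 * π) := by
    rw [ell, Real.log_div ht0.ne' (by positivity)]
  have hlogt : 0 ≤ Real.log t := Real.log_nonneg (by linarith)
  have h6t : 6 / t ≤ 1 / 2 := by rw [div_le_iff₀ ht0]; linarith
  have h6t0 : 0 ≤ 6 / t := by positivity
  have hl2 := log_two_pi_le_two
  have hl2' : 0 ≤ Real.log (2 * π) := Real.log_nonneg (by nlinarith [Real.pi_gt_three])
  have hexp : -((1 + δ - σ) * (ell t / 2 - 6 / t)) + Real.log t * ((1 - σ) / 2) ≤ 3 := by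
    rw [hell]
    have e : -((1 + δ - σ) * ((Real.log t - Real.log (2 * π)) / 2 - 6 / t)) +
        Real.log t * ((1 - σ) / 2) =
        -(δ * Real.log t / 2) + (1 + δ - σ) * (Real.log (2 * π) / 2 + 6 / t) := by ring
    rw [e]
    have hA : (1 + δ - σ) * (Real.log (2 * π) / 2 + 6 / t) ≤ 3 / 2 * (3 / 2) := by
      apply mul_le_mul (by linarith) (by linarith) (by positivity) (by norm_num)
    have hB : 0 ≤ δ * Real.log t / 2 := by positivity
    linarith
  calc Real.exp (-((1 + δ - σ) * (ell t / 2 - 6 / t)) + Real.log t * ((1 - σ) / 2))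
      ≤ Real.exp 3 := Real.exp_le_exp.2 hexp
    _ ≤ 21 := exp_three_lt.le

/-! ## The majorant, case by case -/

/-- Case `½ ≤ σ ≤ 1`: `‖ξ(σ+it)‖ ≤ 672 log t ‖γ̃(1+δ+it)‖`. RH-FREE. [folklore] -/
theorem norm_riemannXi_le_of_half_le {σ δ t : ℝ} (hσ : 1 / 2 ≤ σ) (hσ1 : σ ≤ 1) (hδ : 0 < δ)
    (hδ1 : δ ≤ 1) (ht : 12 ≤ t) :
    ‖riemannXi ((σ : ℂ) + t * I)‖ ≤
      672 * Real.log t * ‖xiGammaFactor (((1 + δ : ℝ) : ℂ) + t * I)‖ := by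
  have ht0 : 0 < t := by linarith
  have hre : 0 < ((σ : ℂ) + t * I).re := by simp; linarith
  have hs1 : ((σ : ℂ) + t * I) ≠ 1 := ofReal_add_mul_I_ne_one ht0.ne'
  rw [norm_riemannXi_eq_mul hre hs1]
  have hζ := norm_riemannZeta_le_convexity_strip hσ hσ1 (by linarith : (8 : ℝ) ≤ t)
  have hγ := norm_xiGammaFactor_le_of_re_le (σ₁ := σ) (σ₂ := 1 + δ) (t := t)
    (by linarith) (by linarith) (by linarith)
  have hE := strip_exponent_le hσ hδ hδ1 ht
  have hlogt : 0 ≤ Real.log t := Real.log_nonneg (by linarith)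
  set G := ‖xiGammaFactor (((1 + δ : ℝ) : ℂ) + t * I)‖ with hG
  have hG0 : 0 ≤ G := norm_nonneg _
  calc ‖xiGammaFactor ((σ : ℂ) + t * I)‖ * ‖riemannZeta ((σ : ℂ) + t * I)‖
      ≤ (G * Real.exp (-((1 + δ - σ) * (ell t / 2 - 6 / t)))) *
          (32 * t ^ ((1 - σ) / 2) * Real.log t) :=
        mul_le_mul hγ hζ (norm_nonneg _) (by positivity)
    _ = 32 * (Real.exp (-((1 + δ - σ) * (ell t / 2 - 6 / t))) * t ^ ((1 - σ) / 2)) *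
          Real.log t * G := by ring
    _ ≤ 32 * 21 * Real.log t * G := by gcongr
    _ = 672 * Real.log t * G := by norm_num

/-- Case `1 ≤ σ ≤ 1 + δ`: `‖ξ(σ+it)‖ ≤ 63 log t ‖γ̃(1+δ+it)‖`. RH-FREE. [folklore] -/
theorem norm_riemannXi_le_of_one_le {σ δ t : ℝ} (hσ : 1 ≤ σ) (hσ1 : σ ≤ 1 + δ) (hδ1 : δ ≤ 1)
    (ht : 12 ≤ t) :
    ‖riemannXi ((σ : ℂ) + t * I)‖ ≤
      63 * Real.log t * ‖xiGammaFactor (((1 + δ : ℝ) : ℂ) + t * I)‖ := by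
  have ht0 : 0 < t := by linarith
  have hre : 0 < ((σ : ℂ) + t * I).re := by simp; linarith
  have hs1 : ((σ : ℂ) + t * I) ≠ 1 := ofReal_add_mul_I_ne_one ht0.ne'
  rw [norm_riemannXi_eq_mul hre hs1]
  -- `‖ζ‖ ≤ 21 log t`
  have hlog1 : 1 < Real.log t := by
    have h3 : Real.log 3 ≤ Real.log t := Real.log_le_log (by norm_num) (by linarith)
    have : 1 < Real.log 3 := by
      rw [Real.lt_log_iff_exp_lt (by norm_num)]
      have := Real.exp_one_lt_d9; linarith
    linarith
  have hζ : ‖riemannZeta ((σ : ℂ) + t * I)‖ ≤ 21 * Real.log t := by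
    have him : ((σ : ℂ) + t * I).im = t := by simp
    have hres : ((σ : ℂ) + t * I).re = σ := by simp
    have h := ZetaOneLine.norm_riemannZeta_le_log (s := (σ : ℂ) + t * I)
      (by rw [him, abs_of_pos ht0]; linarith)
      (by
        rw [him, hres, abs_of_pos ht0]
        have : 0 < 1 / (2 * Real.log t) := by positivity
        linarith)
    rw [him, abs_of_pos ht0] at h
    exact h
  have hγ := norm_xiGammaFactor_le_of_re_le (σ₁ := σ) (σ₂ := 1 + δ) (t := t)
    (by linarith) hσ1 (by linarith)
  -- the exponent is at most `1/2 ≤ 1`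
  have hell0 := ell_nonneg_of_ge ht
  have h6t : 6 / t ≤ 1 / 2 := by rw [div_le_iff₀ ht0]; linarith
  have hexp : -((1 + δ - σ) * (ell t / 2 - 6 / t)) ≤ 1 := by
    have h1 : 0 ≤ 1 + δ - σ := by linarith
    have h2 : 1 + δ - σ ≤ 1 := by linarith
    have e : -((1 + δ - σ) * (ell t / 2 - 6 / t)) =
        (1 + δ - σ) * (6 / t) - (1 + δ - σ) * (ell t / 2) := by ring
    rw [e]
    have h3 : (1 + δ - σ) * (6 / t) ≤ 1 * (1 / 2) :=
      mul_le_mul h2 h6t (by positivity) (by norm_num)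
    have h4 : 0 ≤ (1 + δ - σ) * (ell t / 2) := by positivity
    linarith
  have hexp3 : Real.exp (-((1 + δ - σ) * (ell t / 2 - 6 / t))) ≤ 3 := by
    calc Real.exp (-((1 + δ - σ) * (ell t / 2 - 6 / t))) ≤ Real.exp 1 := Real.exp_le_exp.2 hexp
      _ ≤ 3 := by have := Real.exp_one_lt_d9; linarith
  have hlogt : 0 ≤ Real.log t := by linarith
  set G := ‖xiGammaFactor (((1 + δ : ℝ) : ℂ) + t * I)‖ with hG
  have hG0 : 0 ≤ G := norm_nonneg _
  calc ‖xiGammaFactor ((σ : ℂ) + t * I)‖ * ‖riemannZeta ((σ : ℂ) + t * I)‖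
      ≤ (G * Real.exp (-((1 + δ - σ) * (ell t / 2 - 6 / t)))) * (21 * Real.log t) :=
        mul_le_mul hγ hζ (norm_nonneg _) (by positivity)
    _ = 21 * Real.exp (-((1 + δ - σ) * (ell t / 2 - 6 / t))) * Real.log t * G := by ring
    _ ≤ 21 * 3 * Real.log t * G := by gcongr
    _ = 63 * Real.log t * G := by norm_num

/-! ## The majorant -/

/-- **Flat majorant of `ξ` in the closed strip.** For `0 ≤ σ ≤ 1 + δ`, `0 < δ ≤ 1`, `t ≥ 12`:
`‖ξ(σ + it)‖ ≤ 672 · log t · ‖γ̃(1 + δ + it)‖`. (Convexity bound for `ζ` × horizontal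
monotonicity of `γ̃` on `[½, 1]`; `‖ζ‖ ≤ 21 log t` on `[1, 1+δ]`; reflection on `[0, ½)`.)
RH-FREE. [folklore] -/
theorem norm_riemannXi_le_strip_majorant {σ δ t : ℝ} (hσ0 : 0 ≤ σ) (hσ : σ ≤ 1 + δ)
    (hδ : 0 < δ) (hδ1 : δ ≤ 1) (ht : 12 ≤ t) :
    ‖riemannXi ((σ : ℂ) + t * I)‖ ≤
      672 * Real.log t * ‖xiGammaFactor (((1 + δ : ℝ) : ℂ) + t * I)‖ := by
  have hlogt : 0 ≤ Real.log t := Real.log_nonneg (by linarith)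
  have hG0 : 0 ≤ ‖xiGammaFactor (((1 + δ : ℝ) : ℂ) + t * I)‖ := norm_nonneg _
  rcases lt_or_ge σ (1 / 2) with hlt | hge
  · -- reflect to `1 − σ ∈ (½, 1]`
    rw [norm_riemannXi_reflect σ t]
    exact norm_riemannXi_le_of_half_le (by linarith) (by linarith) hδ hδ1 ht
  rcases le_or_gt σ 1 with hle | hgt
  · exact norm_riemannXi_le_of_half_le hge hle hδ hδ1 ht
  · calc ‖riemannXi ((σ : ℂ) + t * I)‖
        ≤ 63 * Real.log t * ‖xiGammaFactor (((1 + δ : ℝ) : ℂ) + t * I)‖ :=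
          norm_riemannXi_le_of_one_le hgt.le hσ hδ1 ht
      _ ≤ 672 * Real.log t * ‖xiGammaFactor (((1 + δ : ℝ) : ℂ) + t * I)‖ := by
          gcongr; norm_num

/-- **Flat majorant, complex-point form:** for `0 ≤ Re s ≤ 1 + δ`, `0 < δ ≤ 1`, `Im s ≥ 12`:
`‖ξ(s)‖ ≤ 672 · log(Im s) · ‖γ̃(1 + δ + i Im s)‖`. RH-FREE. [folklore] -/
theorem norm_riemannXi_le_strip_majorant' {s : ℂ} {δ : ℝ} (h0 : 0 ≤ s.re) (h1 : s.re ≤ 1 + δ)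
    (hδ : 0 < δ) (hδ1 : δ ≤ 1) (ht : 12 ≤ s.im) :
    ‖riemannXi s‖ ≤ 672 * Real.log s.im * ‖xiGammaFactor (((1 + δ : ℝ) : ℂ) + s.im * I)‖ := by
  have h := norm_riemannXi_le_strip_majorant h0 h1 hδ hδ1 ht
  rwa [Complex.re_add_im] at h

/-- **Vertical comparison, symmetric form:** for `σ > 0` and `t, t′ ≥ t₀ ≥ 2`,
`‖γ̃(σ + it′)‖ ≤ ‖γ̃(σ + it)‖ · exp((π/4 + 6/t₀)|t′ − t|)`. RH-FREE. [folklore] -/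
theorem norm_xiGammaFactor_vertical_le_symm {σ t t' t₀ : ℝ} (hσ : 0 < σ) (ht₀ : 2 ≤ t₀)
    (ht : t₀ ≤ t) (ht' : t₀ ≤ t') :
    ‖xiGammaFactor ((σ : ℂ) + t' * I)‖ ≤
      ‖xiGammaFactor ((σ : ℂ) + t * I)‖ * Real.exp ((π / 4 + 6 / t₀) * |t' - t|) := by
  have ht0pos : 0 < t₀ := by linarith
  have hG0 : 0 ≤ ‖xiGammaFactor ((σ : ℂ) + t * I)‖ := norm_nonneg _
  rcases le_total t t' with hle | hle
  · -- `t ≤ t'`: growth at rate `6/t ≤ 6/t₀ ≤ π/4 + 6/t₀`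
    obtain ⟨h, -⟩ := norm_xiGammaFactor_vertical_le (σ := σ) hσ (ht₀.trans ht) hle
    refine h.trans (mul_le_mul_of_nonneg_left (Real.exp_le_exp.2 ?_) hG0)
    rw [abs_of_nonneg (by linarith)]
    have h6 : 6 / t ≤ 6 / t₀ := div_le_div_of_nonneg_left (by norm_num) ht0pos ht
    have hd : 0 ≤ t' - t := by linarith
    have hπ : 0 ≤ π / 4 := by positivity
    nlinarith
  · -- `t' ≤ t`: decay at rate `π/4 + 6/t' ≤ π/4 + 6/t₀`
    obtain ⟨-, h⟩ := norm_xiGammaFactor_vertical_le (σ := σ) hσ (ht₀.trans ht') hle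
    refine h.trans (mul_le_mul_of_nonneg_left (Real.exp_le_exp.2 ?_) hG0)
    rw [abs_of_nonpos (by linarith)]
    have h6 : 6 / t' ≤ 6 / t₀ := div_le_div_of_nonneg_left (by norm_num) ht0pos ht'
    have hd : 0 ≤ t - t' := by linarith
    have hπ : 0 ≤ π / 4 := by positivity
    nlinarith

end Summit.RiemannHypothesis.RiemannHypothesis.Theorems.JensenPolynomials.LogBandArc

end
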